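import Mathlib
import Summits.CriticalPhenomena.Ising3DConformalLimit.Theorems.PrecisionLaplacianTwoPointSpineGlueParseval
import Summits.CriticalPhenomena.Ising3DConformalLimit.Theorems.PrecisionLaplacianTwoPointSpineGlueSymbolLimit
import Summits.CriticalPhenomena.Ising3DConformalLimit.Theorems.PrecisionLaplacianTwoPointSpineGlueDirichlet
import HarnessLib

/-!
# TwoPointSpineGlue (route PrecisionLaplacian, item stmt-CriticalPhenomena-4805) — the scaling limit of block
# sums of the Green function (sharp Abelian asymptotics)

Helper file 15.  For the Green function `G_q = ∑_n P n` of an even heavy-tailed step law `q` on `ℤ³`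
(symbol bound `1 − φ(k) ≥ c₁‖k‖^α`, tail profile as in `…SymbolLimit`, `0 < α < 2`), the block sums over
pairs of cubes of side `≍ δN` centred at `x_N ≍ N v` and at `0` have a scaling limit:

* `block_scaling_limit` — `N^{-(3+α)} ∑_{u,u' ∈ Λ_{⌊δN⌋}} G_q(x_N + u − u') → Λ(v, δ)` whenever
  `x_N / N → v` coordinatewise.

Proof.  By the polarized Parseval identity (`…Parseval.green_block_two_eq`) the block sum is
`(2π)^{-3} ∫_{[-π,π]³} cos(k·x_N) (∏_j D_M(k_j))² / (1 − φ(k)) dk` (`…Dirichlet.W_cube_eq`); after the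
substitution `k = κ/N` the integrand converges pointwise off the coordinate hyperplanes
(`…Dirichlet.tendsto_inv_mul_dirichletRowSum`, `…SymbolLimit.symbol_scaling_limit` for `N^{-α}/(1 − φ(κ/N))`)
and is dominated by `c₁⁻¹ ∏_j m(κ_j)` (`…Dirichlet.rpow_mul_min_sq_le_majorant`), integrable on `ℝ³`.
Dominated convergence.  No definitions are introduced.
-/

noncomputable section

namespace Summit.CriticalPhenomena.Ising3DConformalLimit.Theorems.SpineGlue

open Finset Real Filter Topology MeasureTheory Literature.Probability.LatticeModels
open Literature.Barriers.CriticalPhenomena Literature.Barriers.CriticalPhenomena.SpreadOutIsing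
open Summit.CriticalPhenomena.Ising3DConformalLimit.Theorems.EtaBoundsTransfer
open scoped BigOperators

/-! ### The scaling limit of the block sums -/

/-- **Scaling limit of the block sums of the Green function** (sharp Abelian asymptotics).  For the Green
function `G_q = ∑_n P n` of an even heavy-tailed step law `q` (symbol bound `1 − φ ≥ c₁‖k‖^α`, `q > 0` at a
site and its forward neighbours, tail profile `Ψ`, `0 < α < 2`), cubes `Λ_{⌊δN⌋}` and centres `x_N` with
`x_N/N → v`:  `N^{-(3+α)} ∑_{u,u' ∈ Λ_{⌊δN⌋}} G_q(x_N + u − u')` converges as `N → ∞`. -/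
theorem block_scaling_limit {q : Site 3 → ℝ} {P : ℕ → Site 3 → ℝ} {c₁ α : ℝ}
    (hα0 : 0 < α) (hα2 : α < 2)
    (hq0 : ∀ y, 0 ≤ q y) (hqs : Summable q) (hq1 : ∑' y, q y = 1) (hqev : ∀ y, q (-y) = q y)
    (y₁ : Site 3) (hy₁ : 0 < q y₁) (hy₁' : ∀ i : Fin 3, 0 < q (y₁ + Pi.single i 1))
    (hP0 : ∀ z, P 0 z = if z = 0 then 1 else 0)
    (hPs : ∀ n z, P (n + 1) z = ∑' y, q y * P n (z - y))
    (hPnn : ∀ n z, 0 ≤ P n z) (hPsum : ∀ n, Summable (P n)) (hPn : ∀ z, Summable fun n => P n z)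
    (hc₁ : 0 < c₁)
    (hlow : ∀ k : Fin 3 → ℝ, ‖k‖ ≤ π → k ≠ 0 →
      c₁ * ‖k‖ ^ α ≤ 1 - ∑' y, q y * Real.cos (phase 3 k y))
    {Ψ : EuclideanSpace ℝ (Fin 3) → ℝ} (hΨc : ContinuousOn Ψ (Metric.sphere 0 1))
    (hT : Tendsto (fun x : Site 3 => q x * ‖siteVec x‖ ^ (3 + α) - Ψ (‖siteVec x‖⁻¹ • siteVec x))
      cofinite (𝓝 0))
    (v : Fin 3 → ℝ) (x : ℕ → Site 3)
    (hx : ∀ j, Tendsto (fun N : ℕ => ((x N j : ℤ) : ℝ) / N) atTop (𝓝 (v j)))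
    {δ : ℝ} (hδ : 0 < δ) :
    ∃ Λ : ℝ, Tendsto (fun N : ℕ => (N : ℝ) ^ (-(3 + α)) *
      ∑ u ∈ box 3 ⌊δ * N⌋₊, ∑ u' ∈ box 3 ⌊δ * N⌋₊, ∑' n, P n (x N + u - u')) atTop (𝓝 Λ) := by
  have hπ := Real.pi_pos
  set K := Set.pi Set.univ (fun _ : Fin 3 => Set.Icc (-π) π) with hK
  have hKm : MeasurableSet K := MeasurableSet.univ_pi fun _ => measurableSet_Icc
  set φ : (Fin 3 → ℝ) → ℝ := fun k => ∑' y, q y * Real.cos (phase 3 k y) with hφ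
  have hφcont : Continuous φ := continuous_fourier_q hqs
  set W : ℕ → (Fin 3 → ℝ) → ℝ := fun N k =>
    Real.cos (phase 3 k (x N)) * (∏ j : Fin 3, dirichletRowSum ⌊δ * N⌋₊ (k j)) ^ 2 with hW
  have hWcont : ∀ N, Continuous (W N) := by
    intro N
    simp only [hW]
    refine Continuous.mul ?_ (Continuous.pow (continuous_finsetProd _ fun j _ => ?_) 2)
    · have := continuous_phase (d := 3) (x N); fun_prop
    · unfold dirichletRowSum
      refine continuous_finsetSum _ fun m _ => ?_
      fun_prop
  -- Step 1: the Parseval identity for the pair of cubes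
  have hpars : ∀ N : ℕ, ∑ u ∈ box 3 ⌊δ * N⌋₊, ∑ u' ∈ box 3 ⌊δ * N⌋₊, ∑' n, P n (x N + u - u')
      = ((2 * π) ^ 3)⁻¹ * ∫ k in K, W N k / (1 - φ k) := by
    intro N
    set M := ⌊δ * N⌋₊ with hM
    set B : Finset (Site 3) := (box 3 M).map (addLeftEmbedding (x N)) with hB
    have h := green_block_two_eq (d := 3) (by norm_num) hα0 (by push_cast; linarith) hq0 hqs hq1 hqev y₁ hy₁ hy₁'
      hP0 hPs hPnn hPsum hPn hc₁ hlow B (box 3 M)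
    have hlhs : ∑ y ∈ B, ∑ y' ∈ box 3 M, ∑' n, P n (y - y')
        = ∑ u ∈ box 3 M, ∑ u' ∈ box 3 M, ∑' n, P n (x N + u - u') := by
      rw [hB, Finset.sum_map]; rfl
    have hrhs : ∀ k, ∑ y ∈ B, ∑ y' ∈ box 3 M, Real.cos (phase 3 k (y - y')) = W N k := by
      intro k
      rw [hB, Finset.sum_map]
      exact W_cube_eq M k (x N)
    rw [hlhs] at h
    rw [h]
    simp_rw [hrhs]
    rfl
  -- Step 2: the substitution `k = κ / N`
  set F : ℕ → (Fin 3 → ℝ) → ℝ := fun N => K.indicator (fun k => W N k / (1 - φ k)) with hF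
  have hFmeas : ∀ N, Measurable (F N) := fun N =>
    ((hWcont N).measurable.div (measurable_const.sub hφcont.measurable)).indicator hKm
  set g : ℕ → (Fin 3 → ℝ) → ℝ := fun N κ => (N : ℝ) ^ (-(6 + α)) * F N ((N : ℝ)⁻¹ • κ) with hg
  have hsubst : ∀ N : ℕ, 0 < N →
      (N : ℝ) ^ (-(3 + α)) * (((2 * π) ^ 3)⁻¹ * ∫ k in K, W N k / (1 - φ k))
        = ((2 * π) ^ 3)⁻¹ * ∫ κ, g N κ := by
    intro N hN
    have hNr : (0 : ℝ) < N := by exact_mod_cast hN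
    have h1 : ∫ k in K, W N k / (1 - φ k) = ∫ k, F N k := (integral_indicator hKm).symm
    have h2 : ∫ κ, F N ((N : ℝ)⁻¹ • κ) = (N : ℝ) ^ 3 * ∫ k, F N k := by
      rw [Measure.integral_comp_smul volume (F N) ((N : ℝ)⁻¹)]
      rw [Module.finrank_fin_fun, smul_eq_mul]
      congr 1
      rw [inv_pow, inv_inv, abs_of_pos (by positivity)]
    have h3 : ∫ k, F N k = ((N : ℝ) ^ 3)⁻¹ * ∫ κ, F N ((N : ℝ)⁻¹ • κ) := by
      rw [h2]; field_simp
    rw [h1, h3]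
    simp only [hg]
    rw [integral_const_mul]
    have hpow : (N : ℝ) ^ (-(3 + α)) * ((N : ℝ) ^ 3)⁻¹ = (N : ℝ) ^ (-(6 + α)) := by
      rw [← Real.rpow_natCast, ← Real.rpow_neg hNr.le, ← Real.rpow_add hNr]
      congr 1; push_cast; ring
    rw [← hpow]
    ring
  -- Step 3: the dominating function
  set cδ : ℝ := 2 * δ + 1 with hcδ
  set bound : (Fin 3 → ℝ) → ℝ := fun κ => c₁⁻¹ * ∏ j, (cδ ^ 2 * (Set.Icc (-π) π).indicator
      (fun t => |t| ^ (-(α / 3))) (κ j) + π ^ 2 * 2 ^ (2 + α / 3) * (1 + |κ j|) ^ (-(2 + α / 3))) with hbound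
  have hbound_int : Integrable bound := (integrable_blockMajorant hα0.le (by linarith) (cδ ^ 2)).const_mul _
  have hfac_nn : ∀ t : ℝ, 0 ≤ cδ ^ 2 * (Set.Icc (-π) π).indicator (fun t => |t| ^ (-(α / 3))) t
      + π ^ 2 * 2 ^ (2 + α / 3) * (1 + |t|) ^ (-(2 + α / 3)) := by
    intro t
    refine add_nonneg (mul_nonneg (sq_nonneg _) ?_) (by positivity)
    by_cases h : t ∈ Set.Icc (-π) π
    · rw [Set.indicator_of_mem h]; exact Real.rpow_nonneg (abs_nonneg _) _
    · rw [Set.indicator_of_notMem h]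
  have hbound_nn : ∀ κ, 0 ≤ bound κ := fun κ =>
    mul_nonneg (inv_nonneg.2 hc₁.le) (Finset.prod_nonneg fun j _ => hfac_nn _)
  have hgmeas : ∀ N, AEStronglyMeasurable (g N) := fun N =>
    (((hFmeas N).comp (measurable_const_smul _)).const_mul _).aestronglyMeasurable
  -- symbol facts at scale `N`
  have hsymbN : ∀ (N : ℕ) (κ : Fin 3 → ℝ), 0 < N → κ ≠ 0 → ‖(N : ℝ)⁻¹ • κ‖ ≤ π →
      c₁ * ((N : ℝ) ^ (-α) * ‖κ‖ ^ α) ≤ 1 - φ ((N : ℝ)⁻¹ • κ) := by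
    intro N κ hN hκ hle
    have hNr : (0 : ℝ) < N := by exact_mod_cast hN
    have hne : (N : ℝ)⁻¹ • κ ≠ 0 := by
      intro h; apply hκ
      have := congrArg (fun w => (N : ℝ) • w) h
      simpa [smul_smul, mul_inv_cancel₀ hNr.ne'] using this
    have h := hlow _ hle hne
    rw [norm_smul, norm_inv, Real.norm_natCast, Real.mul_rpow (inv_nonneg.2 hNr.le) (norm_nonneg _),
      Real.inv_rpow hNr.le, ← Real.rpow_neg hNr.le] at h
    exact h
  -- the pointwise bound
  have hgbound : ∀ N, ∀ᵐ κ, ‖g N κ‖ ≤ bound κ := by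
    intro N
    filter_upwards [ae_forall_coord_ne_zero (d := 3)] with κ hκ0
    have hκ : κ ≠ 0 := fun h => hκ0 0 (by rw [h]; rfl)
    rcases Nat.eq_zero_or_pos N with hN0 | hN
    · -- `N = 0`: the prefactor vanishes
      have : g 0 κ = 0 := by
        simp only [hg, Nat.cast_zero]
        rw [Real.zero_rpow (by linarith), zero_mul]
      rw [hN0, this, norm_zero]; exact hbound_nn κ
    have hNr : (0 : ℝ) < N := by exact_mod_cast hN
    by_cases hmem : (N : ℝ)⁻¹ • κ ∈ K
    swap
    · have : g N κ = 0 := by simp only [hg, hF, Set.indicator_of_notMem hmem, mul_zero]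
      rw [this, norm_zero]; exact hbound_nn κ
    have hle : ‖(N : ℝ)⁻¹ • κ‖ ≤ π := norm_le_pi_of_mem_cube hmem
    have hκj : ∀ j, |κ j| ≤ N * π := by
      intro j
      have h1 : |((N : ℝ)⁻¹ • κ) j| ≤ π := abs_le.2 (hmem j (Set.mem_univ j))
      rw [Pi.smul_apply, smul_eq_mul, abs_mul, abs_of_pos (inv_pos.2 hNr)] at h1
      rwa [inv_mul_le_iff₀ hNr] at h1
    have hsym := hsymbN N κ hN hκ hle
    have hnk : 0 < ‖κ‖ := norm_pos_iff.2 hκ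
    have hden : 0 < 1 - φ ((N : ℝ)⁻¹ • κ) := lt_of_lt_of_le (by positivity) hsym
    -- the value of `g N κ`
    have hgval : g N κ = (N : ℝ) ^ (-(6 + α)) * (W N ((N : ℝ)⁻¹ • κ) / (1 - φ ((N : ℝ)⁻¹ • κ))) := by
      simp only [hg, hF, Set.indicator_of_mem hmem]
    -- bounds on the three factors
    have hWle : |W N ((N : ℝ)⁻¹ • κ)| ≤ (N : ℝ) ^ 6 * ∏ j, (min cδ (π / |κ j|)) ^ 2 := by
      simp only [hW]
      rw [abs_mul]
      have hcos : |Real.cos (phase 3 ((N : ℝ)⁻¹ • κ) (x N))| ≤ 1 := Real.abs_cos_le_one _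
      have hD : |(∏ j : Fin 3, dirichletRowSum ⌊δ * N⌋₊ (((N : ℝ)⁻¹ • κ) j)) ^ 2|
          ≤ (N : ℝ) ^ 6 * ∏ j, (min cδ (π / |κ j|)) ^ 2 := by
        rw [abs_pow, Finset.abs_prod]
        have hj : ∀ j, |dirichletRowSum ⌊δ * N⌋₊ (((N : ℝ)⁻¹ • κ) j)| ≤ N * min cδ (π / |κ j|) := by
          intro j
          have h := abs_inv_mul_dirichletRowSum_le (δ := δ) (θ := κ j) (N := N) (M := ⌊δ * N⌋₊) hN
            (Nat.floor_le (by positivity)) (hκ0 j) (hκj j)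
          rw [abs_mul, abs_of_pos (inv_pos.2 hNr), inv_mul_le_iff₀ hNr] at h
          have : ((N : ℝ)⁻¹ • κ) j = κ j / N := by
            rw [Pi.smul_apply, smul_eq_mul, div_eq_inv_mul]
          rw [this]; exact h
        calc (∏ j, |dirichletRowSum ⌊δ * N⌋₊ (((N : ℝ)⁻¹ • κ) j)|) ^ 2
            ≤ (∏ j, (N : ℝ) * min cδ (π / |κ j|)) ^ 2 :=
              pow_le_pow_left₀ (Finset.prod_nonneg fun j _ => abs_nonneg _)
                (Finset.prod_le_prod (fun j _ => abs_nonneg _) fun j _ => hj j) 2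
          _ = (N : ℝ) ^ 6 * ∏ j, (min cδ (π / |κ j|)) ^ 2 := by
              rw [Finset.prod_mul_distrib, Finset.prod_const, Finset.card_univ, Fintype.card_fin,
                mul_pow, ← Finset.prod_pow]; ring
      calc |Real.cos (phase 3 ((N : ℝ)⁻¹ • κ) (x N))| *
            |(∏ j : Fin 3, dirichletRowSum ⌊δ * N⌋₊ (((N : ℝ)⁻¹ • κ) j)) ^ 2|
          ≤ 1 * ((N : ℝ) ^ 6 * ∏ j, (min cδ (π / |κ j|)) ^ 2) :=
            mul_le_mul hcos hD (abs_nonneg _) zero_le_one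
        _ = _ := one_mul _
    have hinvle : (1 - φ ((N : ℝ)⁻¹ • κ))⁻¹ ≤ c₁⁻¹ * ((N : ℝ) ^ α * ‖κ‖ ^ (-α)) := by
      have h1 : 0 < c₁ * ((N : ℝ) ^ (-α) * ‖κ‖ ^ α) := by positivity
      calc (1 - φ ((N : ℝ)⁻¹ • κ))⁻¹ ≤ (c₁ * ((N : ℝ) ^ (-α) * ‖κ‖ ^ α))⁻¹ := inv_anti₀ h1 hsym
        _ = c₁⁻¹ * ((N : ℝ) ^ α * ‖κ‖ ^ (-α)) := by
            rw [mul_inv, mul_inv, Real.rpow_neg hNr.le, inv_inv, Real.rpow_neg hnk.le]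
    have hprodκ : ‖κ‖ ^ (-α) ≤ ∏ j, |κ j| ^ (-(α / 3)) := by
      have := norm_rpow_neg_le_prod (d := 3) (by norm_num) hα0.le hκ0
      simpa using this
    -- assemble
    rw [Real.norm_eq_abs, hgval, abs_mul, abs_of_nonneg (Real.rpow_nonneg hNr.le _), abs_div,
      abs_of_pos hden, div_eq_mul_inv]
    calc (N : ℝ) ^ (-(6 + α)) * (|W N ((N : ℝ)⁻¹ • κ)| * (1 - φ ((N : ℝ)⁻¹ • κ))⁻¹)
        ≤ (N : ℝ) ^ (-(6 + α)) * (((N : ℝ) ^ 6 * ∏ j, (min cδ (π / |κ j|)) ^ 2) *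
            (c₁⁻¹ * ((N : ℝ) ^ α * ‖κ‖ ^ (-α)))) := by
          refine mul_le_mul_of_nonneg_left ?_ (Real.rpow_nonneg hNr.le _)
          exact mul_le_mul hWle hinvle (inv_nonneg.2 hden.le) (by positivity)
      _ = c₁⁻¹ * (((N : ℝ) ^ (-(6 + α)) * ((N : ℝ) ^ 6 * (N : ℝ) ^ α)) *
            (‖κ‖ ^ (-α) * ∏ j, (min cδ (π / |κ j|)) ^ 2)) := by ring
      _ = c₁⁻¹ * (‖κ‖ ^ (-α) * ∏ j, (min cδ (π / |κ j|)) ^ 2) := by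
          have : (N : ℝ) ^ (-(6 + α)) * ((N : ℝ) ^ 6 * (N : ℝ) ^ α) = 1 := by
            rw [← Real.rpow_natCast, ← Real.rpow_add hNr, ← Real.rpow_add hNr]
            have : -(6 + α) + (((6 : ℕ) : ℝ) + α) = 0 := by push_cast; ring
            rw [this, Real.rpow_zero]
          rw [this, one_mul]
      _ ≤ c₁⁻¹ * ((∏ j, |κ j| ^ (-(α / 3))) * ∏ j, (min cδ (π / |κ j|)) ^ 2) := by
          gcongr
      _ = c₁⁻¹ * ∏ j, (|κ j| ^ (-(α / 3)) * (min cδ (π / |κ j|)) ^ 2) := by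
          rw [← Finset.prod_mul_distrib]
      _ ≤ bound κ := by
          simp only [hbound]
          refine mul_le_mul_of_nonneg_left ?_ (inv_nonneg.2 hc₁.le)
          refine Finset.prod_le_prod (fun j _ => mul_nonneg (Real.rpow_nonneg (abs_nonneg _) _) (sq_nonneg _))
            fun j _ => ?_
          exact rpow_mul_min_sq_le_majorant hα0.le (by rw [hcδ]; linarith) (hκ0 j)
  -- Step 4: the pointwise limit
  have hglim : ∀ᵐ κ, Tendsto (fun N => g N κ) atTop (𝓝 (limUnder atTop fun N => g N κ)) := by
    filter_upwards [ae_forall_coord_ne_zero (d := 3)] with κ hκ0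
    refine tendsto_nhds_limUnder ?_
    have hκ : κ ≠ 0 := fun h => hκ0 0 (by rw [h]; rfl)
    have hnk : 0 < ‖κ‖ := norm_pos_iff.2 hκ
    -- the symbol factor
    have hconv1 : ∀ N : ℕ, 1 - φ ((N : ℝ)⁻¹ • κ) = ∑' y, q y * (1 - Real.cos (phase 3 ((N : ℝ)⁻¹ • κ) y)) := by
      intro N
      have hsc : Summable fun y => q y * Real.cos (phase 3 ((N : ℝ)⁻¹ • κ) y) :=
        Summable.of_norm_bounded hqs fun y => by
          rw [Real.norm_eq_abs, abs_mul, abs_of_nonneg (hq0 y)]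
          exact mul_le_of_le_one_right (hq0 y) (Real.abs_cos_le_one _)
      calc 1 - φ ((N : ℝ)⁻¹ • κ) = ∑' y, q y - ∑' y, q y * Real.cos (phase 3 ((N : ℝ)⁻¹ • κ) y) := by
            rw [hq1]
        _ = ∑' y, (q y - q y * Real.cos (phase 3 ((N : ℝ)⁻¹ • κ) y)) := (hqs.tsum_sub hsc).symm
        _ = _ := tsum_congr fun y => by ring
    obtain ⟨L, hL⟩ := symbol_scaling_limit hα0 hα2 hq0 hqs hΨc hT κ
    have hL' : Tendsto (fun N : ℕ => (N : ℝ) ^ α * (1 - φ ((N : ℝ)⁻¹ • κ))) atTop (𝓝 L) := by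
      simpa only [hconv1] using hL
    have hLpos : 0 < L := by
      have hev : ∀ᶠ N : ℕ in atTop, c₁ * ‖κ‖ ^ α ≤ (N : ℝ) ^ α * (1 - φ ((N : ℝ)⁻¹ • κ)) := by
        have hsmall : ∀ᶠ N : ℕ in atTop, ‖(N : ℝ)⁻¹ • κ‖ ≤ π := by
          have h1 : Tendsto (fun N : ℕ => ‖(N : ℝ)⁻¹ • κ‖) atTop (𝓝 0) := by
            have : Tendsto (fun N : ℕ => (N : ℝ)⁻¹ * ‖κ‖) atTop (𝓝 (0 * ‖κ‖)) :=
              (tendsto_inv_atTop_zero.comp tendsto_natCast_atTop_atTop).mul_const _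
            rw [zero_mul] at this
            refine this.congr fun N => ?_
            rw [norm_smul, norm_inv, Real.norm_natCast]
          exact h1.eventually (ge_mem_nhds hπ)
        filter_upwards [hsmall, eventually_gt_atTop 0] with N hN hNpos
        have hNr : (0 : ℝ) < N := by exact_mod_cast hNpos
        have h := hsymbN N κ hNpos hκ hN
        have : (N : ℝ) ^ α * (c₁ * ((N : ℝ) ^ (-α) * ‖κ‖ ^ α)) = c₁ * ‖κ‖ ^ α := by
          rw [Real.rpow_neg hNr.le]; field_simp
        rw [← this]
        exact mul_le_mul_of_nonneg_left h (Real.rpow_nonneg hNr.le _)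
      have := ge_of_tendsto hL' hev
      exact lt_of_lt_of_le (by positivity) this
    have hinv : Tendsto (fun N : ℕ => ((N : ℝ) ^ α * (1 - φ ((N : ℝ)⁻¹ • κ)))⁻¹) atTop (𝓝 L⁻¹) :=
      hL'.inv₀ hLpos.ne'
    -- the Dirichlet factors
    have hDir : Tendsto (fun N : ℕ => ∏ j, (N : ℝ)⁻¹ * dirichletRowSum ⌊δ * N⌋₊ (κ j / N)) atTop
        (𝓝 (∏ j, 2 * Real.sin (δ * κ j) / κ j)) :=
      tendsto_finsetProd _ fun j _ => tendsto_inv_mul_dirichletRowSum hδ (hκ0 j)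
    -- the cosine factor
    have hcos : Tendsto (fun N : ℕ => Real.cos (phase 3 ((N : ℝ)⁻¹ • κ) (x N))) atTop
        (𝓝 (Real.cos (∑ j, κ j * v j))) := by
      have hph : ∀ N : ℕ, phase 3 ((N : ℝ)⁻¹ • κ) (x N) = ∑ j, κ j * (((x N j : ℤ) : ℝ) / N) := by
        intro N
        simp only [phase, Pi.smul_apply, smul_eq_mul]
        exact Finset.sum_congr rfl fun j _ => by ring
      simp_rw [hph]
      exact (Real.continuous_cos.tendsto _).comp (tendsto_finsetSum _ fun j _ => (hx j).const_mul _)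
    -- eventually `κ/N ∈ K`, where `g N κ` factorises
    have hsmall : ∀ᶠ N : ℕ in atTop, (N : ℝ)⁻¹ • κ ∈ K := by
      have h1 : Tendsto (fun N : ℕ => ‖(N : ℝ)⁻¹ • κ‖) atTop (𝓝 0) := by
        have : Tendsto (fun N : ℕ => (N : ℝ)⁻¹ * ‖κ‖) atTop (𝓝 (0 * ‖κ‖)) :=
          (tendsto_inv_atTop_zero.comp tendsto_natCast_atTop_atTop).mul_const _
        rw [zero_mul] at this
        refine this.congr fun N => ?_
        rw [norm_smul, norm_inv, Real.norm_natCast]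
      filter_upwards [h1.eventually (ge_mem_nhds hπ)] with N hN
      rw [hK, Set.mem_pi]; intro j _
      have : |((N : ℝ)⁻¹ • κ) j| ≤ π := by
        have := norm_le_pi_norm ((N : ℝ)⁻¹ • κ) j; rw [Real.norm_eq_abs] at this; exact this.trans hN
      rw [Set.mem_Icc, ← abs_le]; exact this
    have hfact : ∀ᶠ N : ℕ in atTop, g N κ = Real.cos (phase 3 ((N : ℝ)⁻¹ • κ) (x N)) *
        (∏ j, (N : ℝ)⁻¹ * dirichletRowSum ⌊δ * N⌋₊ (κ j / N)) ^ 2 *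
        ((N : ℝ) ^ α * (1 - φ ((N : ℝ)⁻¹ • κ)))⁻¹ := by
      filter_upwards [hsmall, eventually_gt_atTop 0] with N hmem hN
      have hNr : (0 : ℝ) < N := by exact_mod_cast hN
      simp only [hg, hF, Set.indicator_of_mem hmem, hW]
      have h1 : ∀ j, ((N : ℝ)⁻¹ • κ) j = κ j / N := fun j => by
        rw [Pi.smul_apply, smul_eq_mul, div_eq_inv_mul]
      simp only [h1]
      rw [Finset.prod_mul_distrib, Finset.prod_const, Finset.card_univ, Fintype.card_fin]
      have h6 : (N : ℝ) ^ (-(6 + α)) = ((N : ℝ)⁻¹) ^ 3 * ((N : ℝ)⁻¹) ^ 3 * ((N : ℝ) ^ α)⁻¹ := by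
        rw [← Real.rpow_neg hNr.le, Real.rpow_neg hNr.le α, ← pow_add, inv_pow, ← Real.rpow_natCast,
          ← Real.rpow_neg hNr.le, ← Real.rpow_neg hNr.le, ← Real.rpow_add hNr]
        congr 1; push_cast; ring
      rw [h6]
      field_simp
    have hlim := (hcos.mul (hDir.pow 2)).mul hinv
    exact ⟨_, hlim.congr' (by filter_upwards [hfact] with N hN; rw [hN])⟩
  -- dominated convergence and assembly
  have hDCT := tendsto_integral_of_dominated_convergence bound hgmeas hbound_int hgbound hglim
  refine ⟨((2 * π) ^ 3)⁻¹ * ∫ κ, limUnder atTop (fun N => g N κ), ?_⟩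
  refine (hDCT.const_mul _).congr' ?_
  filter_upwards [eventually_gt_atTop 0] with N hN
  rw [hpars N, hsubst N hN]

end Summit.CriticalPhenomena.Ising3DConformalLimit.Theorems.SpineGlue

end
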